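import Literature.Analysis.FluidPDE.PeriodicCylinderWordNorms
import HarnessLib

/-!
# Interior `H²`-regularity on the period cell: the Hessian identity with a radial cutoff

Topic `Literature/Analysis/FluidPDE`. Support file (all results proved) for the discharge of the
pressure estimate `Literature.Analysis.FluidPDE.Ferrari1993_periodicCylinderPressureEstimate` (A. B.
Ferrari, Comm. Math. Phys. **155** (1993), Lemma 2, pp. 280–281: the standard `H^s` estimate for the
Neumann problem, obtained by "deriving local estimates of this type and combining them"). This file
provides the tools of the **interior** local estimate (away from the wall all constant-direction
derivatives of `q` are controlled by `Δ_K q` and lower-order terms):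

* radial cutoffs `cylRadialCutoff ρ ρ'` (`= 1` on `{r ≤ ρ}`, `= 0` on `{r ≥ ρ'}`, smooth, axially
  invariant), with bounds for their first derivatives and Laplacian within the closed cylinder
  (continuity + axial invariance + compactness of `{r ≤ 1, z = 0}`);
* integration by parts on the cell in a constant direction against a function vanishing on the wall
  (`setIntegral_mul_cylDeriv_add_eq_zero`, from the cell's Gauss–Green theorem
  `setIntegral_mul_divergence_add_fderiv_eq_zero`);
* the **interior Hessian identity** `Σᵢⱼ ‖∂ᵢ∂ⱼ v‖² = ‖Δ_K v‖²` for `v` smooth on the closed cylinder,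
  periodic, whose first and second derivatives vanish on the wall (`sum_setIntegral_hessian_sq_eq`),
  hence `‖∂ᵢ∂ⱼ v‖ ≤ ‖Δ_K v‖` and `‖∂_a ∂_b v‖ ≤ 9‖a‖‖b‖ ‖Δ_K v‖`;
* Leibniz for the Laplacian within, `Δ_K(χ h) = χ Δ_K h + 2 Σᵢ ∂ᵢχ ∂ᵢh + (Δ_K χ) h`.

All statements are folklore calculus.

Mathlib/tree search: Gauss–Green on the cell and the within-calculus are in
`PeriodicCylinderWithinCalculus.lean`; `Real.smoothTransition` (Mathlib) for the cutoff; no interior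
`H²` estimate on the cylinder existed (`lean search 'interior|hessian|cutoff'` in `FluidPDE`: only
parabolic/Stokes interior estimates in other geometries).
-/

noncomputable section

open MeasureTheory Set Function Filter Topology TopologicalSpace WithLp Metric
open scoped ContDiff NNReal ENNReal InnerProductSpace RealInnerProductSpace

namespace Literature.Analysis.FluidPDE

open Literature.Analysis.FunctionSpaces

/-- Local notation for physical space `ℝ³ = EuclideanSpace ℝ (Fin 3)`. -/
local notation "ℝ³" => EuclideanSpace ℝ (Fin 3)

/-- Local notation for the closed unit cylinder `{r ≤ 1}`. -/
local notation "𝕂" => closure (SetLike.coe unitCylinder : Set (EuclideanSpace ℝ (Fin 3)))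

variable {F : Type*} [NormedAddCommGroup F] [NormedSpace ℝ F]

/-! ### Axially invariant continuous functions are bounded on the closed cylinder -/

/-- The slab `{r ≤ 1, z = 0}` is compact. [folklore] -/
theorem isCompact_closure_unitCylinder_inter_slab :
    IsCompact {x : ℝ³ | cylRadius x ≤ 1 ∧ x 2 = 0} := by
  refine Metric.isCompact_of_isClosed_isBounded ?_ ?_
  · exact (isClosed_le continuous_cylRadius continuous_const).inter
      (isClosed_eq (contDiff_cylCoordFun 2).continuous continuous_const)
  · refine (Metric.isBounded_closedBall (x := (0 : ℝ³)) (r := 1)).subset fun x hx => ?_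
    rw [Metric.mem_closedBall, dist_zero_right, EuclideanSpace.norm_eq, Fin.sum_univ_three]
    have h1 : x 0 ^ 2 + x 1 ^ 2 ≤ 1 := by
      rw [← cylRadius_sq]; exact pow_le_one₀ (cylRadius_nonneg x) hx.1
    have h2 : x 2 = 0 := hx.2
    simp only [Real.norm_eq_abs, sq_abs, h2]
    calc Real.sqrt (x 0 ^ 2 + x 1 ^ 2 + 0 ^ 2) ≤ Real.sqrt 1 := Real.sqrt_le_sqrt (by linarith)
      _ = 1 := Real.sqrt_one

omit [NormedSpace ℝ F] in
/-- **A continuous function invariant under axial translations is bounded on the closed cylinder.**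
[folklore] -/
theorem exists_bound_of_axialInvariant {g : ℝ³ → F} (hg : Continuous g)
    (hinv : ∀ (x : ℝ³) (t : ℝ), g (x + t • cylBasis 2) = g x) : ∃ C : ℝ, 0 ≤ C ∧ ∀ x ∈ 𝕂, ‖g x‖ ≤ C := by
  obtain ⟨C, hC⟩ := isCompact_closure_unitCylinder_inter_slab.exists_bound_of_continuousOn hg.continuousOn
  refine ⟨max C 0, le_max_right _ _, fun x hx => ?_⟩
  have hr : cylRadius x ≤ 1 := by rw [closure_unitCylinder] at hx; exact hx
  set x' : ℝ³ := x + (-(x 2)) • cylBasis 2 with hx'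
  have hx'mem : x' ∈ {x : ℝ³ | cylRadius x ≤ 1 ∧ x 2 = 0} := by
    refine ⟨?_, ?_⟩
    · have : cylRadius x' = cylRadius x := by
        simp [hx', cylRadius, cylBasis_apply]
      rw [this]; exact hr
    · simp [hx', cylBasis_apply]
  calc ‖g x‖ = ‖g x'‖ := by rw [hx', hinv]
    _ ≤ C := hC x' hx'mem
    _ ≤ max C 0 := le_max_left _ _

/-! ### Radial cutoffs -/

/-- The radial cutoff `χ_{ρ,ρ'}(x) = smoothTransition ((ρ'² − r²)/(ρ'² − ρ²))`: smooth, `= 1` on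
`{r ≤ ρ}`, `= 0` on `{r ≥ ρ'}` (for `0 < ρ < ρ'`). [folklore] -/
def cylRadialCutoff (ρ ρ' : ℝ) (x : ℝ³) : ℝ :=
  Real.smoothTransition ((ρ' ^ 2 - (x 0 ^ 2 + x 1 ^ 2)) / (ρ' ^ 2 - ρ ^ 2))

section Cutoff

variable {ρ ρ' : ℝ}

/-- The cutoff is smooth. [folklore] -/
theorem contDiff_cylRadialCutoff (ρ ρ' : ℝ) : ContDiff ℝ ∞ (cylRadialCutoff ρ ρ') := by
  unfold cylRadialCutoff
  refine Real.smoothTransition.contDiff.comp ?_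
  exact (contDiff_const.sub (((contDiff_cylCoordFun 0).pow 2).add ((contDiff_cylCoordFun 1).pow 2))).div_const _

/-- The cutoff takes values in `[0, 1]`. [folklore] -/
theorem cylRadialCutoff_mem_Icc (ρ ρ' : ℝ) (x : ℝ³) : cylRadialCutoff ρ ρ' x ∈ Icc (0 : ℝ) 1 :=
  ⟨Real.smoothTransition.nonneg _, Real.smoothTransition.le_one _⟩

/-- `|χ| ≤ 1`. [folklore] -/
theorem abs_cylRadialCutoff_le (ρ ρ' : ℝ) (x : ℝ³) : |cylRadialCutoff ρ ρ' x| ≤ 1 := by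
  obtain ⟨h0, h1⟩ := cylRadialCutoff_mem_Icc ρ ρ' x
  rw [abs_of_nonneg h0]; exact h1

/-- `χ = 1` on `{r ≤ ρ}`. [folklore] -/
theorem cylRadialCutoff_eq_one (hρ : 0 < ρ) (hρρ' : ρ < ρ') {x : ℝ³} (hx : cylRadius x ≤ ρ) :
    cylRadialCutoff ρ ρ' x = 1 := by
  unfold cylRadialCutoff
  refine Real.smoothTransition.one_of_one_le ?_
  have hden : 0 < ρ' ^ 2 - ρ ^ 2 := by nlinarith
  rw [le_div_iff₀ hden, one_mul, ← cylRadius_sq]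
  nlinarith [cylRadius_nonneg x]

/-- `χ = 0` on `{r ≥ ρ'}`. [folklore] -/
theorem cylRadialCutoff_eq_zero (hρ : 0 < ρ) (hρρ' : ρ < ρ') {x : ℝ³} (hx : ρ' ≤ cylRadius x) :
    cylRadialCutoff ρ ρ' x = 0 := by
  unfold cylRadialCutoff
  refine Real.smoothTransition.zero_of_nonpos ?_
  have hden : 0 < ρ' ^ 2 - ρ ^ 2 := by nlinarith
  rw [div_nonpos_iff]
  refine Or.inr ⟨?_, hden.le⟩
  rw [← cylRadius_sq, sub_nonpos]
  nlinarith [cylRadius_nonneg x]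

/-- The cutoff is axially invariant. [folklore] -/
theorem cylRadialCutoff_add_axial (ρ ρ' : ℝ) (x : ℝ³) (t : ℝ) :
    cylRadialCutoff ρ ρ' (x + t • cylBasis 2) = cylRadialCutoff ρ ρ' x := by
  simp [cylRadialCutoff, cylBasis_apply]

/-- The cutoff is `L`-periodic (for every `L`). [folklore] -/
theorem isAxiallyPeriodic_cylRadialCutoff (L ρ ρ' : ℝ) : IsAxiallyPeriodic L (cylRadialCutoff ρ ρ') := fun x =>
  cylRadialCutoff_add_axial ρ ρ' x L

/-- The derivative of the cutoff within the closed cylinder is the classical one. [folklore] -/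
theorem cylDeriv_cylRadialCutoff (V : ℝ³ → ℝ³) {x : ℝ³} (hx : x ∈ 𝕂) :
    cylDeriv V (cylRadialCutoff ρ ρ') x = fderiv ℝ (cylRadialCutoff ρ ρ') x (V x) :=
  cylDeriv_eq_fderiv_of_differentiableAt
    (((contDiff_cylRadialCutoff ρ ρ').differentiable (by simp)).differentiableAt) hx

/-- The classical derivative of the cutoff is axially invariant. [folklore] -/
theorem fderiv_cylRadialCutoff_add_axial (ρ ρ' : ℝ) (x : ℝ³) (t : ℝ) :
    fderiv ℝ (cylRadialCutoff ρ ρ') (x + t • cylBasis 2) = fderiv ℝ (cylRadialCutoff ρ ρ') x := by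
  have h : (fun y => cylRadialCutoff ρ ρ' (y + t • cylBasis 2)) = cylRadialCutoff ρ ρ' :=
    funext fun y => cylRadialCutoff_add_axial ρ ρ' y t
  rw [← fderiv_comp_add_right, h]

/-- The second classical derivatives of the cutoff are axially invariant. [folklore] -/
theorem fderiv_fderiv_cylRadialCutoff_add_axial (ρ ρ' : ℝ) (w : ℝ³) (x : ℝ³) (t : ℝ) :
    fderiv ℝ (fun y => fderiv ℝ (cylRadialCutoff ρ ρ') y w) (x + t • cylBasis 2) =
      fderiv ℝ (fun y => fderiv ℝ (cylRadialCutoff ρ ρ') y w) x := by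
  have h : (fun y => fderiv ℝ (cylRadialCutoff ρ ρ') (y + t • cylBasis 2) w) =
      fun y => fderiv ℝ (cylRadialCutoff ρ ρ') y w :=
    funext fun y => by rw [fderiv_cylRadialCutoff_add_axial]
  rw [← fderiv_comp_add_right, h]

/-- **The first derivatives of the cutoff are bounded on the closed cylinder**:
`|∂_V χ (x)| ≤ A ‖V x‖`. [folklore] -/
theorem exists_bound_cylDeriv_cylRadialCutoff (ρ ρ' : ℝ) :
    ∃ A : ℝ, 0 ≤ A ∧ ∀ (V : ℝ³ → ℝ³) (x : ℝ³), x ∈ 𝕂 → |cylDeriv V (cylRadialCutoff ρ ρ') x| ≤ A * ‖V x‖ := by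
  have hc : Continuous fun y => fderiv ℝ (cylRadialCutoff ρ ρ') y :=
    (contDiff_cylRadialCutoff ρ ρ').continuous_fderiv (by simp)
  obtain ⟨A, hA0, hA⟩ := exists_bound_of_axialInvariant hc (fun x t => fderiv_cylRadialCutoff_add_axial ρ ρ' x t)
  refine ⟨A, hA0, fun V x hx => ?_⟩
  rw [cylDeriv_cylRadialCutoff V hx, ← Real.norm_eq_abs]
  exact (ContinuousLinearMap.le_opNorm _ _).trans (mul_le_mul_of_nonneg_right (hA x hx) (norm_nonneg _))

/-- The second derivative within of the cutoff along constant fields is the classical one. [folklore] -/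
theorem cylDeriv_cylDeriv_cylRadialCutoff (v w : ℝ³) {x : ℝ³} (hx : x ∈ 𝕂) :
    cylDeriv (fun _ => v) (cylDeriv (fun _ => w) (cylRadialCutoff ρ ρ')) x =
      fderiv ℝ (fun y => fderiv ℝ (cylRadialCutoff ρ ρ') y w) x v := by
  have hχ := contDiff_cylRadialCutoff ρ ρ'
  have h1 : EqOn (cylDeriv (fun _ => w) (cylRadialCutoff ρ ρ')) (fun y => fderiv ℝ (cylRadialCutoff ρ ρ') y w) 𝕂 :=
    fun y hy => cylDeriv_cylRadialCutoff _ hy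
  rw [cylDeriv_congr h1 hx]
  have hd : DifferentiableAt ℝ (fun y => fderiv ℝ (cylRadialCutoff ρ ρ') y w) x :=
    ((hχ.fderiv_right (m := ∞) (by simp)).clm_apply contDiff_const).differentiable (by simp) x
  exact cylDeriv_eq_fderiv_of_differentiableAt hd hx

/-- **The Laplacian within of the cutoff is bounded on the closed cylinder.** [folklore] -/
theorem exists_bound_cylLap_cylRadialCutoff (ρ ρ' : ℝ) :
    ∃ B : ℝ, 0 ≤ B ∧ ∀ x ∈ 𝕂, |cylLap (cylRadialCutoff ρ ρ') x| ≤ B := by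
  have hχ := contDiff_cylRadialCutoff ρ ρ'
  have hc : ∀ i : Fin 3, Continuous fun x => fderiv ℝ (fun y => fderiv ℝ (cylRadialCutoff ρ ρ') y (cylBasis i)) x (cylBasis i) :=
    fun i => (((hχ.fderiv_right (m := ∞) (by simp)).clm_apply contDiff_const).continuous_fderiv (by simp)).clm_apply
      continuous_const
  have hb : ∀ i : Fin 3, ∃ C : ℝ, 0 ≤ C ∧ ∀ x ∈ 𝕂,
      ‖fderiv ℝ (fun y => fderiv ℝ (cylRadialCutoff ρ ρ') y (cylBasis i)) x (cylBasis i)‖ ≤ C := fun i =>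
    exists_bound_of_axialInvariant (hc i) fun x t => by rw [fderiv_fderiv_cylRadialCutoff_add_axial]
  choose C hC0 hC using hb
  refine ⟨∑ i, C i, Finset.sum_nonneg fun i _ => hC0 i, fun x hx => ?_⟩
  rw [cylLap_apply]
  refine (Finset.abs_sum_le_sum_abs _ _).trans (Finset.sum_le_sum fun i _ => ?_)
  rw [cylDeriv_cylDeriv_cylRadialCutoff _ _ hx, ← Real.norm_eq_abs]
  exact hC i x hx

end Cutoff

/-! ### Integration by parts in a constant direction against a function vanishing on the wall -/

/-- **Integration by parts on the cell**: for `φ`, `g` of class `C^∞` on the closed cylinder and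
`L`-periodic with `g = 0` on the wall, `∫_cell (φ ∂_v g + ∂_v φ g) = 0` (Gauss–Green for the field
`g v`, which is tangential on the wall). [folklore] -/
theorem setIntegral_mul_cylDeriv_add_eq_zero {L : ℝ} (hL : 0 < L) (v : ℝ³) {φ g : ℝ³ → ℝ}
    (hφ : ContDiffOn ℝ ∞ φ 𝕂) (hg : ContDiffOn ℝ ∞ g 𝕂) (hφp : IsAxiallyPeriodic L φ) (hgp : IsAxiallyPeriodic L g)
    (hwall : ∀ x ∈ frontier (unitCylinder : Set ℝ³), g x = 0) :
    ∫ x in (cylinderCell L : Set ℝ³), (φ x * cylDeriv (fun _ => v) g x + cylDeriv (fun _ => v) φ x * g x) = 0 := by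
  set W : ℝ³ → ℝ³ := fun y => g y • v with hW
  have hWc : ContDiffOn ℝ 1 W 𝕂 := (hg.of_le (by simp)).smul contDiffOn_const
  have hslip : ∀ x ∈ frontier (unitCylinder : Set ℝ³), ⟪W x, eR x⟫ = 0 := fun x hx => by
    simp [hW, hwall x hx]
  have hWp : IsAxiallyPeriodic L W := fun x => by simp only [hW, hgp x]
  have h := setIntegral_mul_divergence_add_fderiv_eq_zero hL (hφ.of_le (by simp)) hWc hslip hφp hWp
  rw [← h]
  refine setIntegral_congr_fun (cylinderCell L).isOpen.measurableSet fun x hx => ?_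
  have hxU : x ∈ (unitCylinder : Set ℝ³) := cylinderCell_le_unitCylinder L hx
  have hxK : 𝕂 ∈ 𝓝 x := mem_of_superset (unitCylinder.isOpen.mem_nhds hxU) subset_closure
  have hgd : DifferentiableAt ℝ g x := (hg.differentiableOn (by simp) x (mem_of_mem_nhds hxK)).differentiableAt hxK
  simp only [hW]
  rw [divergence_smul_const_apply hgd v, cylDeriv_eq_fderiv _ g hxU, cylDeriv_eq_fderiv _ φ hxU,
    map_smul, smul_eq_mul]
  ring

/-! ### The interior Hessian identity -/

section Hessian

variable {L : ℝ} (hL : 0 < L) {v : ℝ³ → ℝ} (hv : ContDiffOn ℝ ∞ v 𝕂) (hvp : IsAxiallyPeriodic L v)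
  (hw1 : ∀ (a : ℝ³), ∀ x ∈ frontier (unitCylinder : Set ℝ³), cylDeriv (fun _ => a) v x = 0)
  (hw2 : ∀ (a b : ℝ³), ∀ x ∈ frontier (unitCylinder : Set ℝ³), cylDeriv (fun _ => a) (cylDeriv (fun _ => b) v) x = 0)

include hL hv hvp hw1 hw2

/-- `∫ (∂_a∂_b v)² = ∫ ∂_a∂_a v · ∂_b∂_b v` for `v` whose first and second derivatives vanish on the
wall (two integrations by parts and the symmetry of mixed derivatives). [folklore] -/
theorem setIntegral_hessian_sq_eq (a b : ℝ³) :
    ∫ x in (cylinderCell L : Set ℝ³), cylDeriv (fun _ => a) (cylDeriv (fun _ => b) v) x ^ 2 =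
      ∫ x in (cylinderCell L : Set ℝ³),
        cylDeriv (fun _ => a) (cylDeriv (fun _ => a) v) x * cylDeriv (fun _ => b) (cylDeriv (fun _ => b) v) x := by
  have hd : ∀ (c : ℝ³) {f : ℝ³ → ℝ}, ContDiffOn ℝ ∞ f 𝕂 → ContDiffOn ℝ ∞ (cylDeriv (fun _ => c) f) 𝕂 :=
    fun c f hf => contDiffOn_cylDeriv contDiff_const hf
  have hp : ∀ (c : ℝ³) {f : ℝ³ → ℝ}, IsAxiallyPeriodic L f → ContDiffOn ℝ ∞ f 𝕂 →
      IsAxiallyPeriodic L (cylDeriv (fun _ => c) f) := fun c f hf _ =>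
    hf.cylDeriv (fun _ => rfl)
  set vb := cylDeriv (fun _ => b) v with hvb
  set va := cylDeriv (fun _ => a) v with hva
  set vab := cylDeriv (fun _ => a) vb with hvab
  set vaa := cylDeriv (fun _ => a) va with hvaa
  set vbb := cylDeriv (fun _ => b) vb with hvbb
  have hvb_s : ContDiffOn ℝ ∞ vb 𝕂 := hd b hv
  have hva_s : ContDiffOn ℝ ∞ va 𝕂 := hd a hv
  have hvab_s : ContDiffOn ℝ ∞ vab 𝕂 := hd a hvb_s
  have hvaa_s : ContDiffOn ℝ ∞ vaa 𝕂 := hd a hva_s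
  have hvb_p : IsAxiallyPeriodic L vb := hp b hvp hv
  have hva_p : IsAxiallyPeriodic L va := hp a hvp hv
  have hvab_p : IsAxiallyPeriodic L vab := hp a hvb_p hvb_s
  have hvaa_p : IsAxiallyPeriodic L vaa := hp a hva_p hva_s
  -- first integration by parts (direction `a`, `g = ∂_a∂_b v` vanishes on the wall)
  have h1 := setIntegral_mul_cylDeriv_add_eq_zero hL a hvb_s hvab_s hvb_p hvab_p (hw2 a b)
  -- second integration by parts (direction `b`, `g = ∂_b v` vanishes on the wall)
  have h2 := setIntegral_mul_cylDeriv_add_eq_zero hL b hvaa_s hvb_s hvaa_p hvb_p (hw1 b)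
  -- symmetry: `∂_a ∂_a ∂_b v = ∂_b ∂_a ∂_a v` on the closed cylinder
  have hsym : EqOn (cylDeriv (fun _ => a) vab) (cylDeriv (fun _ => b) vaa) 𝕂 := by
    intro x hx
    have e1 : EqOn vab (cylDeriv (fun _ => b) va) 𝕂 := fun y hy => cylDeriv_const_comm a b hv hy
    rw [cylDeriv_congr e1 hx, cylDeriv_const_comm a b hva_s hx]
  -- integrability of the pieces (continuous on the closed cylinder)
  haveI : IsFiniteMeasure (volume.restrict (cylinderCell L : Set ℝ³)) :=
    ⟨by rw [Measure.restrict_apply_univ]; exact volume_cylinderCell_lt_top L⟩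
  have hint : ∀ {f : ℝ³ → ℝ}, ContinuousOn f 𝕂 → Integrable f (volume.restrict (cylinderCell L : Set ℝ³)) :=
    fun hf => (memLp_two_cylinderCell_of_continuousOn L hf).integrable (by norm_num)
  have i1 : Integrable (fun x => vb x * cylDeriv (fun _ => a) vab x) (volume.restrict (cylinderCell L : Set ℝ³)) :=
    hint (hvb_s.continuousOn.mul (hd a hvab_s).continuousOn)
  have i2 : Integrable (fun x => vab x ^ 2) (volume.restrict (cylinderCell L : Set ℝ³)) :=
    hint (hvab_s.continuousOn.pow 2)
  have i3 : Integrable (fun x => vaa x * vbb x) (volume.restrict (cylinderCell L : Set ℝ³)) :=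
    hint (hvaa_s.continuousOn.mul (hd b hvb_s).continuousOn)
  have hI1 : ∫ x in (cylinderCell L : Set ℝ³), vab x ^ 2 =
      -∫ x in (cylinderCell L : Set ℝ³), vb x * cylDeriv (fun _ => a) vab x := by
    have hsplit : ∫ x in (cylinderCell L : Set ℝ³), (vb x * cylDeriv (fun _ => a) vab x + cylDeriv (fun _ => a) vb x * vab x) =
        (∫ x in (cylinderCell L : Set ℝ³), vb x * cylDeriv (fun _ => a) vab x) +
          ∫ x in (cylinderCell L : Set ℝ³), vab x ^ 2 := by
      rw [← integral_add i1 i2]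
      refine setIntegral_congr_fun (cylinderCell L).isOpen.measurableSet fun x _ => ?_
      simp only [hvab]; ring
    rw [hsplit] at h1
    linarith
  have hI2 : ∫ x in (cylinderCell L : Set ℝ³), vb x * cylDeriv (fun _ => a) vab x =
      -∫ x in (cylinderCell L : Set ℝ³), vaa x * vbb x := by
    have hsplit : ∫ x in (cylinderCell L : Set ℝ³), (vaa x * cylDeriv (fun _ => b) vb x + cylDeriv (fun _ => b) vaa x * vb x) =
        (∫ x in (cylinderCell L : Set ℝ³), vaa x * vbb x) +
          ∫ x in (cylinderCell L : Set ℝ³), vb x * cylDeriv (fun _ => a) vab x := by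
      rw [← integral_add i3 i1]
      refine setIntegral_congr_fun (cylinderCell L).isOpen.measurableSet fun x hx => ?_
      have hxK : x ∈ 𝕂 := subset_closure (cylinderCell_le_unitCylinder L hx)
      rw [hsym hxK]
      simp only [hvbb]; ring
    rw [hsplit] at h2
    linarith
  rw [hI1, hI2, neg_neg]

/-- **The interior Hessian identity**: `Σᵢⱼ ∫ (∂ᵢ∂ⱼ v)² = ∫ (Δ_K v)²`. [folklore] -/
theorem sum_setIntegral_hessian_sq_eq :
    ∑ i : Fin 3, ∑ j : Fin 3, ∫ x in (cylinderCell L : Set ℝ³),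
        cylDeriv (fun _ => cylBasis i) (cylDeriv (fun _ => cylBasis j) v) x ^ 2 =
      ∫ x in (cylinderCell L : Set ℝ³), cylLap v x ^ 2 := by
  have hd : ∀ (c : ℝ³) {f : ℝ³ → ℝ}, ContDiffOn ℝ ∞ f 𝕂 → ContDiffOn ℝ ∞ (cylDeriv (fun _ => c) f) 𝕂 :=
    fun c f hf => contDiffOn_cylDeriv contDiff_const hf
  haveI : IsFiniteMeasure (volume.restrict (cylinderCell L : Set ℝ³)) :=
    ⟨by rw [Measure.restrict_apply_univ]; exact volume_cylinderCell_lt_top L⟩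
  have hint : ∀ {f : ℝ³ → ℝ}, ContinuousOn f 𝕂 → Integrable f (volume.restrict (cylinderCell L : Set ℝ³)) :=
    fun hf => (memLp_two_cylinderCell_of_continuousOn L hf).integrable (by norm_num)
  have hii : ∀ i : Fin 3, ContinuousOn (cylDeriv (fun _ => cylBasis i) (cylDeriv (fun _ => cylBasis i) v)) 𝕂 :=
    fun i => (hd _ (hd _ hv)).continuousOn
  have hF : ∀ i j : Fin 3, Integrable (fun x => cylDeriv (fun _ => cylBasis i) (cylDeriv (fun _ => cylBasis i) v) x *
      cylDeriv (fun _ => cylBasis j) (cylDeriv (fun _ => cylBasis j) v) x) (volume.restrict (cylinderCell L : Set ℝ³)) :=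
    fun i j => hint ((hii i).mul (hii j))
  have hFi : ∀ i : Fin 3, Integrable (fun x => ∑ j : Fin 3, cylDeriv (fun _ => cylBasis i) (cylDeriv (fun _ => cylBasis i) v) x *
      cylDeriv (fun _ => cylBasis j) (cylDeriv (fun _ => cylBasis j) v) x) (volume.restrict (cylinderCell L : Set ℝ³)) :=
    fun i => integrable_finsetSum _ fun j _ => hF i j
  simp only [setIntegral_hessian_sq_eq hL hv hvp hw1 hw2]
  rw [show (fun x => cylLap v x ^ 2) = fun x => ∑ i : Fin 3, ∑ j : Fin 3,
      cylDeriv (fun _ => cylBasis i) (cylDeriv (fun _ => cylBasis i) v) x *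
        cylDeriv (fun _ => cylBasis j) (cylDeriv (fun _ => cylBasis j) v) x from funext fun x => by
    rw [cylLap_apply, sq, Finset.sum_mul_sum]]
  rw [integral_finsetSum _ fun i _ => hFi i]
  refine Finset.sum_congr rfl fun i _ => ?_
  rw [integral_finsetSum _ fun j _ => hF i j]

/-- **Each second derivative by the Laplacian**: `cellL2 (∂ᵢ∂ⱼ v) ≤ cellL2 (Δ_K v)`. [folklore] -/
theorem cellL2_hessian_basis_le (i j : Fin 3) :
    cellL2 L (cylDeriv (fun _ => cylBasis i) (cylDeriv (fun _ => cylBasis j) v)) ≤ cellL2 L (cylLap v) := by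
  have hd : ∀ (c : ℝ³) {f : ℝ³ → ℝ}, ContDiffOn ℝ ∞ f 𝕂 → ContDiffOn ℝ ∞ (cylDeriv (fun _ => c) f) 𝕂 :=
    fun c f hf => contDiffOn_cylDeriv contDiff_const hf
  have hsq : ∀ i j : Fin 3, ∫ x in (cylinderCell L : Set ℝ³),
      cylDeriv (fun _ => cylBasis i) (cylDeriv (fun _ => cylBasis j) v) x ^ 2 =
        cellL2 L (cylDeriv (fun _ => cylBasis i) (cylDeriv (fun _ => cylBasis j) v)) ^ 2 := fun i j => by
    rw [← integral_norm_sq_eq_cellL2_sq L (hd _ (hd _ hv)).continuousOn]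
    simp only [Real.norm_eq_abs, sq_abs]
  have hL2 : ∫ x in (cylinderCell L : Set ℝ³), cylLap v x ^ 2 = cellL2 L (cylLap v) ^ 2 := by
    rw [← integral_norm_sq_eq_cellL2_sq L (contDiffOn_cylLap hv).continuousOn]
    simp only [Real.norm_eq_abs, sq_abs]
  have h := sum_setIntegral_hessian_sq_eq hL hv hvp hw1 hw2
  simp only [hsq, hL2] at h
  have hle : cellL2 L (cylDeriv (fun _ => cylBasis i) (cylDeriv (fun _ => cylBasis j) v)) ^ 2 ≤ cellL2 L (cylLap v) ^ 2 := by
    rw [← h]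
    refine le_trans ?_ (Finset.single_le_sum (f := fun i => ∑ j : Fin 3,
      cellL2 L (cylDeriv (fun _ => cylBasis i) (cylDeriv (fun _ => cylBasis j) v)) ^ 2)
      (fun i _ => Finset.sum_nonneg fun j _ => sq_nonneg _) (Finset.mem_univ i))
    exact Finset.single_le_sum (f := fun j => cellL2 L (cylDeriv (fun _ => cylBasis i) (cylDeriv (fun _ => cylBasis j) v)) ^ 2)
      (fun j _ => sq_nonneg _) (Finset.mem_univ j)
  exact (pow_le_pow_iff_left₀ (cellL2_nonneg L _) (cellL2_nonneg L _) two_ne_zero).1 hle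

omit hL hv hvp hw1 hw2 in
/-- A vector in coordinates: `a = Σᵢ aᵢ eᵢ`. [folklore] -/
theorem eq_sum_smul_cylBasis (a : ℝ³) : a = ∑ i : Fin 3, a i • cylBasis i := by
  ext j
  fin_cases j <;> simp [Fin.sum_univ_three, cylBasis_apply]

omit hL hvp hw1 hw2 in
/-- `∂_a ∂_b v = Σᵢⱼ aᵢ bⱼ ∂ᵢ ∂ⱼ v` on the closed cylinder. [folklore] -/
theorem cylDeriv_cylDeriv_eq_sum (a b : ℝ³) {x : ℝ³} (hx : x ∈ 𝕂) :
    cylDeriv (fun _ => a) (cylDeriv (fun _ => b) v) x =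
      ∑ i : Fin 3, ∑ j : Fin 3, (a i * b j) * cylDeriv (fun _ => cylBasis i) (cylDeriv (fun _ => cylBasis j) v) x := by
  have hd : ∀ (c : ℝ³) {f : ℝ³ → ℝ}, ContDiffOn ℝ ∞ f 𝕂 → ContDiffOn ℝ ∞ (cylDeriv (fun _ => c) f) 𝕂 :=
    fun c f hf => contDiffOn_cylDeriv contDiff_const hf
  -- the inner derivative in coordinates, as a function
  have hb : cylDeriv (fun _ => b) v = fun y => ∑ j : Fin 3, b j * cylDeriv (fun _ => cylBasis j) v y := by
    funext y
    rw [cylDeriv_apply]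
    conv_lhs => rw [eq_sum_smul_cylBasis b]
    rw [map_sum]
    simp only [map_smul, smul_eq_mul, cylDeriv_apply]
  rw [hb, cylDeriv_finset_sum _ (fun j _ => contDiffOn_const.mul (hd _ hv)) hx]
  -- the outer derivative in coordinates
  have houter : ∀ (F' : ℝ³ → ℝ), cylDeriv (fun _ => a) F' x = ∑ i : Fin 3, a i * cylDeriv (fun _ => cylBasis i) F' x := by
    intro F'
    rw [cylDeriv_apply]
    conv_lhs => rw [eq_sum_smul_cylBasis a]
    rw [map_sum]
    simp only [map_smul, smul_eq_mul, cylDeriv_apply]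
  rw [Finset.sum_comm]
  refine Finset.sum_congr rfl fun j _ => ?_
  have hsm : ContDiffOn ℝ ∞ (fun y => b j * cylDeriv (fun _ => cylBasis j) v y) 𝕂 := contDiffOn_const.mul (hd _ hv)
  rw [houter]
  refine Finset.sum_congr rfl fun i _ => ?_
  have e : (fun y => b j * cylDeriv (fun _ => cylBasis j) v y) = fun y => b j • cylDeriv (fun _ => cylBasis j) v y := rfl
  rw [e, cylDeriv_const_smul (b j) (hd _ hv) hx, smul_eq_mul]
  ring

/-- **General directions**: `cellL2 (∂_a ∂_b v) ≤ 9 ‖a‖ ‖b‖ cellL2 (Δ_K v)`. [folklore] -/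
theorem cellL2_hessian_le (a b : ℝ³) :
    cellL2 L (cylDeriv (fun _ => a) (cylDeriv (fun _ => b) v)) ≤ 9 * ‖a‖ * ‖b‖ * cellL2 L (cylLap v) := by
  have hd : ∀ (c : ℝ³) {f : ℝ³ → ℝ}, ContDiffOn ℝ ∞ f 𝕂 → ContDiffOn ℝ ∞ (cylDeriv (fun _ => c) f) 𝕂 :=
    fun c f hf => contDiffOn_cylDeriv contDiff_const hf
  have hij : ∀ i j : Fin 3, ContinuousOn (cylDeriv (fun _ => cylBasis i) (cylDeriv (fun _ => cylBasis j) v)) 𝕂 :=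
    fun i j => (hd _ (hd _ hv)).continuousOn
  have hexp : EqOn (cylDeriv (fun _ => a) (cylDeriv (fun _ => b) v))
      (fun x => ∑ i : Fin 3, ∑ j : Fin 3, (a i * b j) * cylDeriv (fun _ => cylBasis i) (cylDeriv (fun _ => cylBasis j) v) x) 𝕂 :=
    fun x hx => cylDeriv_cylDeriv_eq_sum hv a b hx
  have e1 : cellL2 L (cylDeriv (fun _ => a) (cylDeriv (fun _ => b) v)) =
      cellL2 L (fun x => ∑ i : Fin 3, ∑ j : Fin 3, (a i * b j) * cylDeriv (fun _ => cylBasis i) (cylDeriv (fun _ => cylBasis j) v) x) := by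
    simp only [cellL2]
    congr 1
    exact eLpNorm_congr_ae (ae_restrict_of_forall_mem (cylinderCell L).isOpen.measurableSet
      fun x hx => hexp (subset_closure (cylinderCell_le_unitCylinder L hx)))
  rw [e1]
  have hai : ∀ i, |a i| ≤ ‖a‖ := fun i => by simpa using PiLp.norm_apply_le a i
  have hbj : ∀ j, |b j| ≤ ‖b‖ := fun j => by simpa using PiLp.norm_apply_le b j
  calc cellL2 L (fun x => ∑ i : Fin 3, ∑ j : Fin 3, (a i * b j) * cylDeriv (fun _ => cylBasis i) (cylDeriv (fun _ => cylBasis j) v) x)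
      ≤ ∑ i : Fin 3, cellL2 L (fun x => ∑ j : Fin 3, (a i * b j) * cylDeriv (fun _ => cylBasis i) (cylDeriv (fun _ => cylBasis j) v) x) :=
        cellL2_sum_le L _ fun i _ => continuousOn_finsetSum _ fun j _ => continuousOn_const.mul (hij i j)
    _ ≤ ∑ i : Fin 3, ∑ j : Fin 3, cellL2 L (fun x => (a i * b j) * cylDeriv (fun _ => cylBasis i) (cylDeriv (fun _ => cylBasis j) v) x) :=
        Finset.sum_le_sum fun i _ => cellL2_sum_le L _ fun j _ => continuousOn_const.mul (hij i j)
    _ = ∑ i : Fin 3, ∑ j : Fin 3, |a i * b j| * cellL2 L (cylDeriv (fun _ => cylBasis i) (cylDeriv (fun _ => cylBasis j) v)) := by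
        refine Finset.sum_congr rfl fun i _ => Finset.sum_congr rfl fun j _ => ?_
        have h := cellL2_const_smul L (a i * b j) (cylDeriv (fun _ => cylBasis i) (cylDeriv (fun _ => cylBasis j) v))
        simpa only [smul_eq_mul] using h
    _ ≤ ∑ _i : Fin 3, ∑ _j : Fin 3, ‖a‖ * ‖b‖ * cellL2 L (cylLap v) := by
        refine Finset.sum_le_sum fun i _ => Finset.sum_le_sum fun j _ => ?_
        rw [abs_mul]
        have h1 := cellL2_hessian_basis_le hL hv hvp hw1 hw2 i j
        have h2 : |a i| * |b j| ≤ ‖a‖ * ‖b‖ := mul_le_mul (hai i) (hbj j) (abs_nonneg _) (norm_nonneg _)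
        exact mul_le_mul h2 h1 (cellL2_nonneg L _) (by positivity)
    _ = 9 * ‖a‖ * ‖b‖ * cellL2 L (cylLap v) := by
        simp only [Finset.sum_const, Finset.card_univ, Fintype.card_fin, nsmul_eq_mul]
        ring

end Hessian

/-! ### Leibniz for the Laplacian within, vanishing near the wall, commuting with constant words -/

/-- **Leibniz for the Laplacian within**: `Δ_K(φ h) = φ Δ_K h + 2 Σᵢ ∂ᵢφ ∂ᵢh + (Δ_K φ) h`. [folklore] -/
theorem cylLap_smul {φ : ℝ³ → ℝ} {h : ℝ³ → F} (hφ : ContDiffOn ℝ ∞ φ 𝕂) (hh : ContDiffOn ℝ ∞ h 𝕂)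
    {x : ℝ³} (hx : x ∈ 𝕂) :
    cylLap (fun y => φ y • h y) x = φ x • cylLap h x +
      (2 : ℝ) • ∑ i : Fin 3, cylDeriv (fun _ => cylBasis i) φ x • cylDeriv (fun _ => cylBasis i) h x + cylLap φ x • h x := by
  have hdφ : ∀ i : Fin 3, ContDiffOn ℝ ∞ (cylDeriv (fun _ => cylBasis i) φ) 𝕂 := fun i => contDiffOn_cylDeriv contDiff_const hφ
  have hdh : ∀ i : Fin 3, ContDiffOn ℝ ∞ (cylDeriv (fun _ => cylBasis i) h) 𝕂 := fun i => contDiffOn_cylDeriv contDiff_const hh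
  have hterm : ∀ i : Fin 3, cylDeriv (fun _ => cylBasis i) (cylDeriv (fun _ => cylBasis i) (fun y => φ y • h y)) x =
      φ x • cylDeriv (fun _ => cylBasis i) (cylDeriv (fun _ => cylBasis i) h) x +
        (2 : ℝ) • (cylDeriv (fun _ => cylBasis i) φ x • cylDeriv (fun _ => cylBasis i) h x) +
        cylDeriv (fun _ => cylBasis i) (cylDeriv (fun _ => cylBasis i) φ) x • h x := by
    intro i
    have hin : EqOn (cylDeriv (fun _ => cylBasis i) (fun y => φ y • h y))
        (fun y => cylDeriv (fun _ => cylBasis i) φ y • h y + φ y • cylDeriv (fun _ => cylBasis i) h y) 𝕂 :=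
      fun y hy => cylDeriv_smul hφ hh hy
    have hs1 : ContDiffOn ℝ ∞ (fun y => cylDeriv (fun _ => cylBasis i) φ y • h y) 𝕂 := (hdφ i).smul hh
    have hs2 : ContDiffOn ℝ ∞ (fun y => φ y • cylDeriv (fun _ => cylBasis i) h y) 𝕂 := hφ.smul (hdh i)
    rw [cylDeriv_congr hin hx, cylDeriv_add hs1 hs2 hx,
      cylDeriv_smul (hdφ i) hh hx, cylDeriv_smul hφ (hdh i) hx, two_smul]
    abel
  rw [cylLap_apply]
  simp only [hterm, Finset.sum_add_distrib, cylLap_apply, Finset.smul_sum, ← Finset.sum_smul]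

/-- The Laplacian within respects agreement on the closed cylinder. [folklore] -/
theorem cylLap_congr {f g : ℝ³ → F} (h : EqOn f g 𝕂) : EqOn (cylLap f) (cylLap g) 𝕂 := by
  intro x hx
  rw [cylLap_apply, cylLap_apply]
  refine Finset.sum_congr rfl fun i _ => ?_
  exact cylDeriv_congr (fun y hy => cylDeriv_congr h hy) hx

/-- **A function vanishing on `{r > ρ'}` has vanishing derivatives within there.** [folklore] -/
theorem cylDeriv_eq_zero_of_eqOn_zero {ρ' : ℝ} {f : ℝ³ → F} (V : ℝ³ → ℝ³)
    (hf : ∀ y ∈ 𝕂, ρ' < cylRadius y → f y = 0) {x : ℝ³} (hx : x ∈ 𝕂) (hxr : ρ' < cylRadius x) :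
    cylDeriv V f x = 0 := by
  have hO : IsOpen {y : ℝ³ | ρ' < cylRadius y} := isOpen_lt continuous_const continuous_cylRadius
  have hev : f =ᶠ[𝓝[𝕂] x] fun _ => (0 : F) := by
    have h1 : ∀ᶠ y in 𝓝[𝕂] x, y ∈ {y : ℝ³ | ρ' < cylRadius y} :=
      mem_nhdsWithin_of_mem_nhds (hO.mem_nhds hxr)
    have h2 : ∀ᶠ y in 𝓝[𝕂] x, y ∈ 𝕂 := self_mem_nhdsWithin
    filter_upwards [h1, h2] with y hy1 hy2
    exact hf y hy2 hy1
  rw [cylDeriv_apply, hev.fderivWithin_eq (hf x hx hxr), fderivWithin_fun_const]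
  rfl

/-- All derivatives within of a function vanishing on `{r > ρ'}` vanish there (the property is
hereditary). [folklore] -/
theorem cylDeriv_vanish_of_vanish {ρ' : ℝ} {f : ℝ³ → F} (V : ℝ³ → ℝ³)
    (hf : ∀ y ∈ 𝕂, ρ' < cylRadius y → f y = 0) :
    ∀ y ∈ 𝕂, ρ' < cylRadius y → cylDeriv V f y = 0 := fun _ hy hyr =>
  cylDeriv_eq_zero_of_eqOn_zero V hf hy hyr

/-- **The Laplacian within commutes with constant words** (word form of `cylLap_cylDeriv_const`).
[folklore] -/
theorem cylLap_cylWord_const : ∀ (vs : List ℝ³) {f : ℝ³ → F}, ContDiffOn ℝ ∞ f 𝕂 →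
    EqOn (cylLap (cylWord (jcWord (vs.map some)) f)) (cylWord (jcWord (vs.map some)) (cylLap f)) 𝕂
  | [], _, _ => fun _ _ => rfl
  | v :: vs, f, hf => by
    intro x hx
    have hW : ContDiffOn ℝ ∞ (cylWord (jcWord (vs.map some)) f) 𝕂 := contDiffOn_cylWord_jcWord _ hf
    rw [List.map_cons, jcWord_cons, cylWord_cons, cylWord_cons, jcField_some, cylLap_cylDeriv_const hW v hx]
    exact cylDeriv_congr (cylLap_cylWord_const vs hf) hx

/-- A constant derivative passes through a constant word (no commutator terms). [folklore] -/
theorem cylDeriv_const_cylWord_const (w : ℝ³) (vs : List ℝ³) {g : ℝ³ → F} (hg : ContDiffOn ℝ ∞ g 𝕂) :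
    EqOn (cylDeriv (fun _ => w) (cylWord (jcWord (vs.map some)) g))
      (cylWord (jcWord (vs.map some)) (cylDeriv (fun _ => w) g)) 𝕂 := by
  intro x hx
  rw [cylDeriv_const_cylWord_jcWord w (vs.map some) hg hx]
  have hzero : ∀ i ∈ Finset.range (vs.map some).length,
      (bif ((vs.map some)[i]?).elim false Option.isNone then
        cylWord (jcWord ((vs.map some).set i (some (rotGen w)))) g x else (0 : F)) = 0 := by
    intro i hi
    have hi' : i < vs.length := by simpa using hi
    have : ((vs.map some)[i]?).elim false Option.isNone = false := by
      rw [List.getElem?_map, List.getElem?_eq_getElem hi']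
      rfl
    rw [this]
    rfl
  simp only [Finset.sum_eq_zero hzero, add_zero]

/-- Nonempty constant words do not see additive constants. [folklore] -/
theorem cylWord_const_sub_const (v : ℝ³) (vs : List ℝ³) (f : ℝ³ → ℝ) (c : ℝ) :
    cylWord (jcWord ((vs ++ [v]).map some)) (fun y => f y - c) = cylWord (jcWord ((vs ++ [v]).map some)) f := by
  rw [List.map_append, jcWord_append, cylWord_append, cylWord_append]
  congr 1
  show cylDeriv (fun _ => v) (fun y => f y - c) = cylDeriv (fun _ => v) f
  exact cylDeriv_sub_const _ f c

/-! ### The `L²` size on an interior region of the cell -/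

/-- The `L²` size on `cell ∩ {r < ρ}` as a real number. [folklore] -/
def cellL2In (L ρ : ℝ) (f : ℝ³ → F) : ℝ :=
  (eLpNorm f 2 (volume.restrict ((cylinderCell L : Set ℝ³) ∩ {x | cylRadius x < ρ}))).toReal

section CellL2In

/-- The interior region is measurable. [folklore] -/
theorem measurableSet_ball_radius (ρ : ℝ) : MeasurableSet {x : ℝ³ | cylRadius x < ρ} :=
  (isOpen_lt continuous_cylRadius continuous_const).measurableSet

omit [NormedSpace ℝ F] in
/-- `cellL2In` is nonnegative. [folklore] -/
theorem cellL2In_nonneg (L ρ : ℝ) (f : ℝ³ → F) : 0 ≤ cellL2In L ρ f := ENNReal.toReal_nonneg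

omit [NormedSpace ℝ F] in
/-- The interior size is at most the size on the cell. [folklore] -/
theorem cellL2In_le_cellL2 (L ρ : ℝ) {f : ℝ³ → F} (hf : ContinuousOn f 𝕂) : cellL2In L ρ f ≤ cellL2 L f := by
  refine ENNReal.toReal_mono (memLp_two_cylinderCell_of_continuousOn L hf).eLpNorm_ne_top ?_
  exact eLpNorm_mono_measure f (Measure.restrict_mono inter_subset_left le_rfl)

omit [NormedSpace ℝ F] in
/-- The interior size is monotone in the radius. [folklore] -/
theorem cellL2In_mono_radius (L : ℝ) {ρ ρ' : ℝ} (h : ρ ≤ ρ') {f : ℝ³ → F} (hf : ContinuousOn f 𝕂) :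
    cellL2In L ρ f ≤ cellL2In L ρ' f := by
  have hfin : eLpNorm f 2 (volume.restrict ((cylinderCell L : Set ℝ³) ∩ {x | cylRadius x < ρ'})) ≠ ⊤ :=
    ne_top_of_le_ne_top (memLp_two_cylinderCell_of_continuousOn L hf).eLpNorm_ne_top
      (eLpNorm_mono_measure f (Measure.restrict_mono inter_subset_left le_rfl))
  refine ENNReal.toReal_mono hfin (eLpNorm_mono_measure f (Measure.restrict_mono ?_ le_rfl))
  exact inter_subset_inter_right _ fun x hx => lt_of_lt_of_le hx h

omit [NormedSpace ℝ F] in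
/-- The interior size only sees the values on `cell ∩ {r < ρ}`. [folklore] -/
theorem cellL2In_congr (L ρ : ℝ) {f g : ℝ³ → F}
    (h : ∀ x ∈ (cylinderCell L : Set ℝ³), cylRadius x < ρ → f x = g x) : cellL2In L ρ f = cellL2In L ρ g := by
  simp only [cellL2In]
  congr 1
  exact eLpNorm_congr_ae (ae_restrict_of_forall_mem
    ((cylinderCell L).isOpen.measurableSet.inter (measurableSet_ball_radius ρ)) fun x hx => h x hx.1 hx.2)

/-- **A factor supported in `{r < ρ}` and bounded by `A` localises the size**:
`cellL2 (ψ • F) ≤ A · cellL2In ρ F`. [folklore] -/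
theorem cellL2_smul_le_cellL2In (L : ℝ) {ρ A : ℝ} (hA : 0 ≤ A) {ψ : ℝ³ → ℝ} {f : ℝ³ → F}
    (hψ0 : ∀ x ∈ 𝕂, ρ ≤ cylRadius x → ψ x = 0) (hψA : ∀ x ∈ 𝕂, |ψ x| ≤ A) (hf : ContinuousOn f 𝕂) :
    cellL2 L (fun x => ψ x • f x) ≤ A * cellL2In L ρ f := by
  have hS := measurableSet_ball_radius ρ
  -- pointwise: `‖ψ f‖ ≤ ‖indicator {r<ρ} (A • f)‖` on the cell
  have hpt : ∀ x ∈ (cylinderCell L : Set ℝ³), ‖ψ x • f x‖ ≤ ‖({x : ℝ³ | cylRadius x < ρ}).indicator (fun y => A • f y) x‖ := by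
    intro x hx
    have hxK : x ∈ 𝕂 := subset_closure (cylinderCell_le_unitCylinder L hx)
    by_cases hr : cylRadius x < ρ
    · rw [indicator_of_mem (show x ∈ {x : ℝ³ | cylRadius x < ρ} from hr), norm_smul, norm_smul,
        Real.norm_eq_abs, Real.norm_of_nonneg hA]
      exact mul_le_mul_of_nonneg_right (hψA x hxK) (norm_nonneg _)
    · rw [hψ0 x hxK (not_lt.1 hr), zero_smul, norm_zero]
      exact norm_nonneg _
  have h1 : eLpNorm (fun x => ψ x • f x) 2 (volume.restrict (cylinderCell L : Set ℝ³)) ≤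
      eLpNorm (({x : ℝ³ | cylRadius x < ρ}).indicator (fun y => A • f y)) 2 (volume.restrict (cylinderCell L : Set ℝ³)) :=
    eLpNorm_mono_ae ((ae_restrict_iff' (cylinderCell L).isOpen.measurableSet).2 (Eventually.of_forall hpt))
  rw [eLpNorm_indicator_eq_eLpNorm_restrict hS, Measure.restrict_restrict hS,
    show (fun y => A • f y) = A • f from rfl, eLpNorm_const_smul, inter_comm] at h1
  have hfin : eLpNorm f 2 (volume.restrict ((cylinderCell L : Set ℝ³) ∩ {x | cylRadius x < ρ})) ≠ ⊤ :=
    ne_top_of_le_ne_top (memLp_two_cylinderCell_of_continuousOn L hf).eLpNorm_ne_top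
      (eLpNorm_mono_measure f (Measure.restrict_mono inter_subset_left le_rfl))
  rw [cellL2, cellL2In]
  calc (eLpNorm (fun x => ψ x • f x) 2 (volume.restrict (cylinderCell L : Set ℝ³))).toReal
      ≤ (‖A‖ₑ * eLpNorm f 2 (volume.restrict ((cylinderCell L : Set ℝ³) ∩ {x | cylRadius x < ρ}))).toReal :=
        ENNReal.toReal_mono (ENNReal.mul_ne_top (by simp) hfin) h1
    _ = A * (eLpNorm f 2 (volume.restrict ((cylinderCell L : Set ℝ³) ∩ {x | cylRadius x < ρ}))).toReal := by
        rw [ENNReal.toReal_mul, Real.enorm_eq_ofReal_abs, ENNReal.toReal_ofReal (abs_nonneg A), abs_of_nonneg hA]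

omit [NormedSpace ℝ F] in
/-- The interior size is bounded below through a cutoff equal to one on the region: if `g = f` on
`cell ∩ {r < ρ}` then `cellL2In ρ f ≤ cellL2 g`. [folklore] -/
theorem cellL2In_le_cellL2_of_eqOn (L ρ : ℝ) {f g : ℝ³ → F} (hg : ContinuousOn g 𝕂)
    (h : ∀ x ∈ (cylinderCell L : Set ℝ³), cylRadius x < ρ → f x = g x) : cellL2In L ρ f ≤ cellL2 L g := by
  rw [cellL2In_congr L ρ h]
  exact cellL2In_le_cellL2 L ρ hg

end CellL2In

/-! ### Locality of constant words on interior regions -/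

/-- **Constant words are local on the open regions `{r < ρ}` (`ρ ≤ 1`)**: functions agreeing there
have the same constant words there. [folklore] -/
theorem cylWord_const_eqOn_of_eqOn {ρ : ℝ} (hρ : ρ ≤ 1) : ∀ (vs : List ℝ³) {f g : ℝ³ → F},
    EqOn f g {x : ℝ³ | cylRadius x < ρ} →
      EqOn (cylWord (jcWord (vs.map some)) f) (cylWord (jcWord (vs.map some)) g) {x : ℝ³ | cylRadius x < ρ}
  | [], _, _, h => by simpa using h
  | v :: vs, f, g, h => by
    intro x hx
    have hO : IsOpen {x : ℝ³ | cylRadius x < ρ} := isOpen_lt continuous_cylRadius continuous_const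
    have hxU : x ∈ (unitCylinder : Set ℝ³) := lt_of_lt_of_le hx hρ
    have ih := cylWord_const_eqOn_of_eqOn hρ vs h
    rw [List.map_cons, jcWord_cons, cylWord_cons, cylWord_cons, jcField_some,
      cylDeriv_eq_fderiv _ _ hxU, cylDeriv_eq_fderiv _ _ hxU,
      (eventuallyEq_of_mem (hO.mem_nhds hx) ih).fderiv_eq]

/-! ### Constant words in the basis, pointwise -/

/-- **A word of constant letters of norm `≤ M` is bounded pointwise on the closed cylinder by the
words in the basis**: `‖∂_{v₁}⋯∂_{v_n} g (x)‖ ≤ (Λ M)ⁿ Σ_{w : Fin n → ι} ‖X_{e∘w} g (x)‖`,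
`Λ = Σ_k ‖ℓ_k‖`. [folklore] -/
theorem norm_cylWord_const_le_sum_basisWords {M : ℝ} (hM : 0 ≤ M) :
    ∀ (vs : List ℝ³), (∀ v ∈ vs, ‖v‖ ≤ M) → ∀ {g : ℝ³ → F}, ContDiffOn ℝ ∞ g 𝕂 → ∀ {x : ℝ³}, x ∈ 𝕂 →
      ‖cylWord (jcWord (vs.map some)) g x‖ ≤
        ((∑ k, ‖LinearMap.toContinuousLinearMap ((Module.finBasis ℝ ℝ³).coord k)‖) * M) ^ vs.length *
          ∑ w : Fin vs.length → Fin (Module.finrank ℝ ℝ³),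
            ‖cylWord (jcWord (constWord fun j => Module.finBasis ℝ ℝ³ (w j))) g x‖
  | [], _, g, _, x, _ => by
    simp only [List.map_nil, jcWord_nil, cylWord_nil, List.length_nil, pow_zero, one_mul]
    rw [sum_fin_zero_fun, constWord_zero, jcWord_nil, cylWord_nil]
  | v :: vs, hvs, g, hg, x, hx => by
    set b := Module.finBasis ℝ ℝ³ with hb
    set Λ : ℝ := ∑ k, ‖LinearMap.toContinuousLinearMap (b.coord k)‖ with hΛ
    have hΛ0 : 0 ≤ Λ := Finset.sum_nonneg fun k _ => norm_nonneg _
    have hv : ‖v‖ ≤ M := hvs v (List.mem_cons_self ..)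
    have hvs' : ∀ w ∈ vs, ‖w‖ ≤ M := fun w hw => hvs w (List.mem_cons_of_mem _ hw)
    have hW : ContDiffOn ℝ ∞ (cylWord (jcWord (vs.map some)) g) 𝕂 := contDiffOn_cylWord_jcWord _ hg
    rw [List.map_cons, jcWord_cons, cylWord_cons, jcField_some, List.length_cons]
    -- expand the outer letter
    have h1 := norm_cylDeriv_le_sum_coord b (fun _ => v) (cylWord (jcWord (vs.map some)) g) x
    refine h1.trans ?_
    -- each basis derivative passes inside, then the induction hypothesis for `∂_{e_k} g`
    have h2 : ∀ k, ‖cylDeriv (fun _ => b k) (cylWord (jcWord (vs.map some)) g) x‖ ≤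
        (Λ * M) ^ vs.length * ∑ w : Fin vs.length → Fin (Module.finrank ℝ ℝ³),
          ‖cylWord (jcWord (constWord fun j => b ((Fin.cons k w : Fin (vs.length + 1) → _) j))) g x‖ := by
      intro k
      rw [cylDeriv_const_cylWord_const (b k) vs hg hx]
      have h := norm_cylWord_const_le_sum_basisWords hM vs hvs' (g := cylDeriv (fun _ => b k) g)
        (contDiffOn_cylDeriv contDiff_const hg) hx
      refine h.trans (le_of_eq ?_)
      congr 1
      refine Finset.sum_congr rfl fun w _ => ?_
      rw [cylWord_constWord_cylDeriv]
    calc ∑ k, ‖LinearMap.toContinuousLinearMap (b.coord k)‖ * ‖(fun _ : ℝ³ => v) x‖ *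
          ‖cylDeriv (fun _ => b k) (cylWord (jcWord (vs.map some)) g) x‖
        ≤ ∑ k, ‖LinearMap.toContinuousLinearMap (b.coord k)‖ * M *
            ((Λ * M) ^ vs.length * ∑ w : Fin vs.length → Fin (Module.finrank ℝ ℝ³),
              ‖cylWord (jcWord (constWord fun j => b ((Fin.cons k w : Fin (vs.length + 1) → _) j))) g x‖) := by
          refine Finset.sum_le_sum fun k _ => ?_
          have h0 : 0 ≤ ‖LinearMap.toContinuousLinearMap (b.coord k)‖ := norm_nonneg _
          exact mul_le_mul (mul_le_mul_of_nonneg_left hv h0) (h2 k) (norm_nonneg _) (by positivity)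
      _ ≤ ∑ k, Λ * M * ((Λ * M) ^ vs.length * ∑ w : Fin vs.length → Fin (Module.finrank ℝ ℝ³),
              ‖cylWord (jcWord (constWord fun j => b ((Fin.cons k w : Fin (vs.length + 1) → _) j))) g x‖) := by
          refine Finset.sum_le_sum fun k _ => ?_
          refine mul_le_mul_of_nonneg_right (mul_le_mul_of_nonneg_right ?_ hM)
            (mul_nonneg (by positivity) (Finset.sum_nonneg fun w _ => norm_nonneg _))
          exact Finset.single_le_sum (f := fun k => ‖LinearMap.toContinuousLinearMap (b.coord k)‖)
            (fun _ _ => norm_nonneg _) (Finset.mem_univ k)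
      _ = (Λ * M) ^ (vs.length + 1) * ∑ k, ∑ w : Fin vs.length → Fin (Module.finrank ℝ ℝ³),
              ‖cylWord (jcWord (constWord fun j => b ((Fin.cons k w : Fin (vs.length + 1) → _) j))) g x‖ := by
          rw [Finset.mul_sum, ← Finset.sum_congr rfl fun k _ => ?_]
          ring
      _ = (Λ * M) ^ (vs.length + 1) * ∑ w : Fin (vs.length + 1) → Fin (Module.finrank ℝ ℝ³),
              ‖cylWord (jcWord (constWord fun j => b (w j))) g x‖ := by
          rw [sum_fin_succ_fun]

/-! ### The interior induction -/

section Interior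

/-- Unfolding the outermost letter of a constant word. [folklore] -/
theorem cylWord_const_cons (a : ℝ³) (vs : List ℝ³) (f : ℝ³ → F) :
    cylWord (jcWord ((a :: vs).map some)) f = cylDeriv (fun _ => a) (cylWord (jcWord (vs.map some)) f) := rfl

/-- Nonempty constant words do not see additive constants. [folklore] -/
theorem cylWord_const_sub_const' : ∀ (vs : List ℝ³), vs ≠ [] → ∀ (f : ℝ³ → ℝ) (c : ℝ),
    cylWord (jcWord (vs.map some)) (fun y => f y - c) = cylWord (jcWord (vs.map some)) f
  | [], h, _, _ => absurd rfl h
  | [v], _, f, c => by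
    rw [cylWord_const_cons, cylWord_const_cons]
    simp only [List.map_nil, jcWord_nil, cylWord_nil]
    exact cylDeriv_sub_const _ f c
  | v :: w :: vs, _, f, c => by
    rw [cylWord_const_cons, cylWord_const_cons v (w :: vs), cylWord_const_sub_const' (w :: vs) (List.cons_ne_nil _ _) f c]

/-- Constant words of periodic functions are periodic. [folklore] -/
theorem isAxiallyPeriodic_cylWord_const {L : ℝ} (vs : List ℝ³) {f : ℝ³ → F} (hf : IsAxiallyPeriodic L f) :
    IsAxiallyPeriodic L (cylWord (jcWord (vs.map some)) f) :=
  hf.cylWord fun V hV x => by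
    obtain ⟨X, hX, rfl⟩ := List.mem_map.1 hV
    obtain ⟨a, -, rfl⟩ := List.mem_map.1 hX
    rfl

variable {L : ℝ} (hL : 0 < L) {M : ℝ} (hM1 : 1 ≤ M)

include hL hM1

omit hL in
/-- **The base of the interior induction**: `cellL2In ρ (∂_v q) ≤ M cellL2 (∇q)` for `‖v‖ ≤ M`.
[folklore] -/
theorem cellL2In_cylDeriv_le (ρ : ℝ) {q : ℝ³ → ℝ} (hq : ContDiffOn ℝ ∞ q 𝕂) {v : ℝ³} (hv : ‖v‖ ≤ M) :
    cellL2In L ρ (cylWord (jcWord ([v].map some)) q) ≤ M * cellL2 L (cylGrad q) := by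
  have hM0 : 0 ≤ M := zero_le_one.trans hM1
  rw [cylWord_const_cons]
  simp only [List.map_nil, jcWord_nil, cylWord_nil]
  refine (cellL2In_le_cellL2 L ρ (contDiffOn_cylDeriv contDiff_const hq).continuousOn).trans ?_
  calc cellL2 L (cylDeriv (fun _ => v) q) ≤ cellL2 L (fun x => ‖v‖ • cylGrad q x) := by
        have hc : ContinuousOn (fun x => ‖v‖ • cylGrad q x) 𝕂 :=
          ((contDiffOn_const (c := ‖v‖)).smul (contDiffOn_cylGrad hq)).continuousOn
        refine cellL2_mono L hc fun x _ => ?_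
        rw [norm_smul, norm_norm, norm_cylGrad]
        exact norm_cylDeriv_le _ q x
    _ = |‖v‖| * cellL2 L (cylGrad q) := cellL2_const_smul L ‖v‖ (cylGrad q)
    _ ≤ M * cellL2 L (cylGrad q) := by
        rw [abs_of_nonneg (norm_nonneg v)]
        exact mul_le_mul_of_nonneg_right hv (cellL2_nonneg L _)

/-- **The step of the interior induction.** Let `0 < ρ₁ < ρ₀ ≤ 1`, `k ≤ 2`, and suppose the constant
words of `q` of lengths `1, …, k+1` (letters of norm `≤ M`) are bounded on `{r < ρ₀}` by `C_k 𝒟(q)`,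
where `𝒟(q) = Σ_{m ≤ 2} Σ_w cellL2 (X_{e∘w} Δ_K q) + cellL2 (∇q)`. Then the constant words of length
`k + 2` are bounded on `{r < ρ₁}` by `C 𝒟(q)`. Proof: for the word `∂_a∂_b X_{vs'}`, put
`h = X_{vs'}(q − ⨍q)`, `χ = cylRadialCutoff ρ₁ ρ*` (`ρ* = (ρ₁+ρ₀)/2`), `v = χ h`; on `{r < ρ₁}` the word
is `∂_a∂_b v` (locality), `‖∂_a∂_b v‖ ≤ 9M²‖Δ_K v‖` (interior Hessian identity, `v` vanishes near the
wall), and `Δ_K v = χ X_{vs'}Δ_K q + 2Σᵢ ∂ᵢχ ∂ᵢh + (Δ_K χ) h` is controlled on `{r < ρ₀}` by the data,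
the induction hypothesis and (for `k = 0`) the Poincaré inequality on the cell. [folklore] -/
theorem cellL2In_step {ρ₁ ρ₀ : ℝ} (hρ₁ : 0 < ρ₁) (h10 : ρ₁ < ρ₀) (hρ₀ : ρ₀ ≤ 1)
    (k : ℕ) (hk : k ≤ 2) {Ck : ℝ} (hCk : 0 ≤ Ck) :
    ∃ C : ℝ, 0 ≤ C ∧ ∀ (q : ℝ³ → ℝ), ContDiffOn ℝ ∞ q 𝕂 → IsAxiallyPeriodic L q →
      (∀ vs : List ℝ³, 1 ≤ vs.length → vs.length ≤ k + 1 → (∀ v ∈ vs, ‖v‖ ≤ M) →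
        cellL2In L ρ₀ (cylWord (jcWord (vs.map some)) q) ≤
          Ck * (∑ m ∈ Finset.range 3, ∑ w : Fin m → Fin (Module.finrank ℝ ℝ³),
            cellL2 L (cylWord (jcWord (constWord fun j => Module.finBasis ℝ ℝ³ (w j))) (cylLap q)) + cellL2 L (cylGrad q))) →
      ∀ vs : List ℝ³, vs.length = k + 2 → (∀ v ∈ vs, ‖v‖ ≤ M) →
        cellL2In L ρ₁ (cylWord (jcWord (vs.map some)) q) ≤
          C * (∑ m ∈ Finset.range 3, ∑ w : Fin m → Fin (Module.finrank ℝ ℝ³),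
            cellL2 L (cylWord (jcWord (constWord fun j => Module.finBasis ℝ ℝ³ (w j))) (cylLap q)) + cellL2 L (cylGrad q)) := by
  have hM0 : 0 ≤ M := zero_le_one.trans hM1
  set b := Module.finBasis ℝ ℝ³ with hb
  set Λ : ℝ := ∑ k, ‖LinearMap.toContinuousLinearMap (b.coord k)‖ with hΛ
  have hΛ0 : 0 ≤ Λ := Finset.sum_nonneg fun k _ => norm_nonneg _
  -- the cutoff and its bounds
  set ρs : ℝ := (ρ₁ + ρ₀) / 2 with hρs
  have hρ1s : ρ₁ < ρs := by rw [hρs]; linarith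
  have hρs0 : ρs < ρ₀ := by rw [hρs]; linarith
  set χ : ℝ³ → ℝ := cylRadialCutoff ρ₁ ρs with hχ
  obtain ⟨A, hA0, hA⟩ := exists_bound_cylDeriv_cylRadialCutoff ρ₁ ρs
  obtain ⟨B, hB0, hB⟩ := exists_bound_cylLap_cylRadialCutoff ρ₁ ρs
  obtain ⟨CP, hCP0, hCP⟩ := exists_cellL2_sub_average_le hL
  -- the constant
  refine ⟨9 * M ^ 2 * ((Λ * M) ^ k + 6 * A * Ck + B * (Ck + CP)), by positivity, ?_⟩
  intro q hq hqp IH vs hvs hletters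
  -- notation for the data
  set 𝒟 : ℝ := (∑ m ∈ Finset.range 3, ∑ w : Fin m → Fin (Module.finrank ℝ ℝ³),
    cellL2 L (cylWord (jcWord (constWord fun j => b (w j))) (cylLap q)) + cellL2 L (cylGrad q)) with h𝒟
  have h𝒟0 : 0 ≤ 𝒟 := add_nonneg (Finset.sum_nonneg fun m _ => Finset.sum_nonneg fun w _ => cellL2_nonneg L _)
    (cellL2_nonneg L _)
  -- decompose the word
  obtain ⟨a, vs₁, rfl⟩ := List.exists_of_length_succ vs hvs
  have hvs₁ : vs₁.length = k + 1 := by simpa using hvs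
  obtain ⟨a', vs', rfl⟩ := List.exists_of_length_succ vs₁ hvs₁
  have hvs' : vs'.length = k := by simpa using hvs₁
  have ha : ‖a‖ ≤ M := hletters a (by simp)
  have ha' : ‖a'‖ ≤ M := hletters a' (by simp)
  have hl' : ∀ v ∈ vs', ‖v‖ ≤ M := fun v hv => hletters v (by simp [hv])
  -- the functions `q̃`, `h`, `v`
  set qt : ℝ³ → ℝ := fun y => q y - ⨍ y in (cylinderCell L : Set ℝ³), q y with hqt
  have hqt_s : ContDiffOn ℝ ∞ qt 𝕂 := hq.sub contDiffOn_const
  have hqt_p : IsAxiallyPeriodic L qt := fun x => by simp only [hqt, hqp x]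
  set h : ℝ³ → ℝ := cylWord (jcWord (vs'.map some)) qt with hh
  have hh_s : ContDiffOn ℝ ∞ h 𝕂 := contDiffOn_cylWord_jcWord _ hqt_s
  have hh_p : IsAxiallyPeriodic L h := isAxiallyPeriodic_cylWord_const vs' hqt_p
  have hχ_s : ContDiffOn ℝ ∞ χ 𝕂 := (contDiff_cylRadialCutoff ρ₁ ρs).contDiffOn
  set v : ℝ³ → ℝ := fun y => χ y • h y with hv
  have hv_s : ContDiffOn ℝ ∞ v 𝕂 := hχ_s.smul hh_s
  have hv_p : IsAxiallyPeriodic L v := fun x => by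
    simp only [hv]
    rw [hh_p x, hχ, isAxiallyPeriodic_cylRadialCutoff L ρ₁ ρs x]
  -- `v` vanishes on `{r > ρ*}`, hence its derivatives vanish on the wall
  have hv0 : ∀ y ∈ 𝕂, ρs < cylRadius y → v y = 0 := fun y _ hy => by
    simp only [hv, hχ, cylRadialCutoff_eq_zero hρ₁ hρ1s hy.le, zero_smul]
  have hwallr : ∀ x ∈ frontier (unitCylinder : Set ℝ³), x ∈ 𝕂 ∧ ρs < cylRadius x := fun x hx => by
    refine ⟨frontier_subset_closure hx, ?_⟩
    rw [frontier_unitCylinder] at hx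
    rw [show cylRadius x = 1 from hx]
    linarith
  have hw1 : ∀ (c : ℝ³), ∀ x ∈ frontier (unitCylinder : Set ℝ³), cylDeriv (fun _ => c) v x = 0 := fun c x hx =>
    cylDeriv_eq_zero_of_eqOn_zero _ hv0 (hwallr x hx).1 (hwallr x hx).2
  have hw2 : ∀ (c d : ℝ³), ∀ x ∈ frontier (unitCylinder : Set ℝ³),
      cylDeriv (fun _ => c) (cylDeriv (fun _ => d) v) x = 0 := fun c d x hx =>
    cylDeriv_eq_zero_of_eqOn_zero _ (cylDeriv_vanish_of_vanish _ hv0) (hwallr x hx).1 (hwallr x hx).2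
  -- step 1: on `{r < ρ₁}` the word is `∂_a ∂_a' v`
  have step1 : cellL2In L ρ₁ (cylWord (jcWord ((a :: a' :: vs').map some)) q) ≤
      cellL2 L (cylDeriv (fun _ => a) (cylDeriv (fun _ => a') v)) := by
    have hvh : EqOn v h {x : ℝ³ | cylRadius x < ρ₁} := fun x hx => by
      simp only [hv, hχ, cylRadialCutoff_eq_one hρ₁ hρ1s (le_of_lt hx), one_smul]
    have hloc := cylWord_const_eqOn_of_eqOn (F := ℝ) (by linarith : ρ₁ ≤ 1) [a, a'] hvh
    have hword : cylWord (jcWord ((a :: a' :: vs').map some)) q = cylWord (jcWord ([a, a'].map some)) h := by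
      rw [hh, ← cylWord_const_sub_const' (a :: a' :: vs') (List.cons_ne_nil _ _) q
        (⨍ y in (cylinderCell L : Set ℝ³), q y)]
      rw [show (a :: a' :: vs') = [a, a'] ++ vs' from rfl, List.map_append, jcWord_append, cylWord_append]
    refine cellL2In_le_cellL2_of_eqOn L ρ₁
      (contDiffOn_cylDeriv contDiff_const (contDiffOn_cylDeriv contDiff_const hv_s)).continuousOn
      fun x _ hxr => ?_
    rw [hword, ← hloc hxr]
    rfl
  -- step 2: the Hessian of `v` by its Laplacian
  have step2 : cellL2 L (cylDeriv (fun _ => a) (cylDeriv (fun _ => a') v)) ≤ 9 * M ^ 2 * cellL2 L (cylLap v) := by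
    refine (cellL2_hessian_le hL hv_s hv_p hw1 hw2 a a').trans ?_
    have h1 : 9 * ‖a‖ * ‖a'‖ ≤ 9 * M ^ 2 := by nlinarith [norm_nonneg a, norm_nonneg a']
    exact mul_le_mul_of_nonneg_right h1 (cellL2_nonneg L _)
  -- step 3: the Laplacian of `v = χ h`
  have hdχ : ∀ i : Fin 3, ContDiffOn ℝ ∞ (cylDeriv (fun _ => cylBasis i) χ) 𝕂 := fun i => contDiffOn_cylDeriv contDiff_const hχ_s
  have hdh : ∀ i : Fin 3, ContDiffOn ℝ ∞ (cylDeriv (fun _ => cylBasis i) h) 𝕂 := fun i => contDiffOn_cylDeriv contDiff_const hh_s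
  have hT1 : ContinuousOn (fun x => χ x • cylLap h x) 𝕂 := (hχ_s.continuousOn).smul (contDiffOn_cylLap hh_s).continuousOn
  have hT2i : ∀ i : Fin 3, ContinuousOn (fun x => cylDeriv (fun _ => cylBasis i) χ x • cylDeriv (fun _ => cylBasis i) h x) 𝕂 :=
    fun i => (hdχ i).continuousOn.smul (hdh i).continuousOn
  have hT2 : ContinuousOn (fun x => (2 : ℝ) • ∑ i : Fin 3, cylDeriv (fun _ => cylBasis i) χ x • cylDeriv (fun _ => cylBasis i) h x) 𝕂 :=
    ((contDiffOn_const (c := (2 : ℝ))).smul (ContDiffOn.sum (s := Finset.univ) fun i _ => (hdχ i).smul (hdh i))).continuousOn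
  have hT3 : ContinuousOn (fun x => cylLap χ x • h x) 𝕂 := (contDiffOn_cylLap hχ_s).continuousOn.smul hh_s.continuousOn
  have step3 : cellL2 L (cylLap v) ≤ cellL2 L (fun x => χ x • cylLap h x) +
      cellL2 L (fun x => (2 : ℝ) • ∑ i : Fin 3, cylDeriv (fun _ => cylBasis i) χ x • cylDeriv (fun _ => cylBasis i) h x) +
      cellL2 L (fun x => cylLap χ x • h x) := by
    have hid : EqOn (cylLap v) (fun x => (χ x • cylLap h x +
        (2 : ℝ) • ∑ i : Fin 3, cylDeriv (fun _ => cylBasis i) χ x • cylDeriv (fun _ => cylBasis i) h x) +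
        cylLap χ x • h x) 𝕂 := fun x hx => cylLap_smul hχ_s hh_s hx
    have e1 : cellL2 L (cylLap v) = cellL2 L (fun x => (χ x • cylLap h x +
        (2 : ℝ) • ∑ i : Fin 3, cylDeriv (fun _ => cylBasis i) χ x • cylDeriv (fun _ => cylBasis i) h x) +
        cylLap χ x • h x) := by
      simp only [cellL2]
      congr 1
      exact eLpNorm_congr_ae (ae_restrict_of_forall_mem (cylinderCell L).isOpen.measurableSet
        fun x hx => hid (subset_closure (cylinderCell_le_unitCylinder L hx)))
    rw [e1]
    exact (cellL2_add_le L (hT1.add hT2) hT3).trans (add_le_add (cellL2_add_le L hT1 hT2) le_rfl)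
  -- step 3a: `χ Δ_K h` by the data
  have step3a : cellL2 L (fun x => χ x • cylLap h x) ≤ (Λ * M) ^ k * 𝒟 := by
    have hχ0 : ∀ x ∈ 𝕂, ρ₀ ≤ cylRadius x → χ x = 0 := fun x _ hx =>
      cylRadialCutoff_eq_zero hρ₁ hρ1s (hρs0.le.trans hx)
    have hχ1 : ∀ x ∈ 𝕂, |χ x| ≤ 1 := fun x _ => abs_cylRadialCutoff_le _ _ x
    refine (cellL2_smul_le_cellL2In L zero_le_one hχ0 hχ1 (contDiffOn_cylLap hh_s).continuousOn).trans ?_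
    rw [one_mul]
    -- `Δ_K h = X_{vs'} Δ_K q` on the closed cylinder
    have hLh : EqOn (cylLap h) (cylWord (jcWord (vs'.map some)) (cylLap q)) 𝕂 := by
      intro x hx
      rw [hh, cylLap_cylWord_const vs' hqt_s hx, hqt, cylLap_sub_const]
    have hWs : ContDiffOn ℝ ∞ (cylWord (jcWord (vs'.map some)) (cylLap q)) 𝕂 :=
      contDiffOn_cylWord_jcWord _ (contDiffOn_cylLap hq)
    calc cellL2In L ρ₀ (cylLap h) ≤ cellL2 L (cylWord (jcWord (vs'.map some)) (cylLap q)) :=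
          cellL2In_le_cellL2_of_eqOn L ρ₀ hWs.continuousOn fun x hx _ =>
            hLh (subset_closure (cylinderCell_le_unitCylinder L hx))
      _ ≤ cellL2 L (fun x => (Λ * M) ^ vs'.length * ∑ w : Fin vs'.length → Fin (Module.finrank ℝ ℝ³),
            ‖cylWord (jcWord (constWord fun j => b (w j))) (cylLap q) x‖) := by
          refine cellL2_mono L (continuousOn_const.mul (continuousOn_finsetSum _ fun w _ =>
            (contDiffOn_cylWord_jcWord _ (contDiffOn_cylLap hq)).continuousOn.norm)) fun x hx => ?_
          have hxK : x ∈ 𝕂 := subset_closure (cylinderCell_le_unitCylinder L hx)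
          rw [Real.norm_of_nonneg (mul_nonneg (by positivity) (Finset.sum_nonneg fun w _ => norm_nonneg _))]
          exact norm_cylWord_const_le_sum_basisWords hM0 vs' hl' (contDiffOn_cylLap hq) hxK
      _ ≤ (Λ * M) ^ k * ∑ w : Fin k → Fin (Module.finrank ℝ ℝ³),
            cellL2 L (cylWord (jcWord (constWord fun j => b (w j))) (cylLap q)) := by
          have hc : ∀ w : Fin k → Fin (Module.finrank ℝ ℝ³),
              ContinuousOn (fun x => ‖cylWord (jcWord (constWord fun j => b (w j))) (cylLap q) x‖) 𝕂 := fun w =>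
            (contDiffOn_cylWord_jcWord _ (contDiffOn_cylLap hq)).continuousOn.norm
          rw [hvs', cellL2_const_mul L (by positivity)]
          refine mul_le_mul_of_nonneg_left ?_ (by positivity)
          refine (cellL2_sum_le L _ fun w _ => hc w).trans (le_of_eq ?_)
          exact Finset.sum_congr rfl fun w _ => cellL2_norm L _
      _ ≤ (Λ * M) ^ k * 𝒟 := by
          refine mul_le_mul_of_nonneg_left ?_ (by positivity)
          have hk3 : k ∈ Finset.range 3 := Finset.mem_range.2 (by omega)
          have h1 := Finset.single_le_sum (f := fun m => ∑ w : Fin m → Fin (Module.finrank ℝ ℝ³),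
            cellL2 L (cylWord (jcWord (constWord fun j => b (w j))) (cylLap q)))
            (fun m _ => Finset.sum_nonneg fun w _ => cellL2_nonneg L _) hk3
          have h2 := cellL2_nonneg L (cylGrad q)
          simp only [h𝒟]
          linarith
  -- the vanishing of `χ` and its derivatives on `{r ≥ ρ₀}`
  have hχ0' : ∀ y ∈ 𝕂, ρs < cylRadius y → χ y = 0 := fun y _ hy => cylRadialCutoff_eq_zero hρ₁ hρ1s hy.le
  have hdχ0 : ∀ (i : Fin 3), ∀ x ∈ 𝕂, ρ₀ ≤ cylRadius x → cylDeriv (fun _ => cylBasis i) χ x = 0 := fun i x hx hxr =>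
    cylDeriv_eq_zero_of_eqOn_zero _ hχ0' hx (lt_of_lt_of_le hρs0 hxr)
  have hLχ0 : ∀ x ∈ 𝕂, ρ₀ ≤ cylRadius x → cylLap χ x = 0 := fun x hx hxr => by
    rw [cylLap_apply]
    exact Finset.sum_eq_zero fun i _ =>
      cylDeriv_eq_zero_of_eqOn_zero _ (cylDeriv_vanish_of_vanish _ hχ0') hx (lt_of_lt_of_le hρs0 hxr)
  -- the induction hypothesis for `∂ᵢ h` and for `h`
  have hIHi : ∀ i : Fin 3, cellL2In L ρ₀ (cylDeriv (fun _ => cylBasis i) h) ≤ Ck * 𝒟 := by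
    intro i
    have hword : cylDeriv (fun _ => cylBasis i) h = cylWord (jcWord ((cylBasis i :: vs').map some)) q := by
      rw [hh, ← cylWord_const_cons, cylWord_const_sub_const' _ (List.cons_ne_nil _ _)]
    rw [hword]
    refine IH _ (by simp) (by simp [hvs']) fun v hv => ?_
    rcases List.mem_cons.1 hv with rfl | hv
    · rw [norm_cylBasis]; exact hM1
    · exact hl' v hv
  have hIHh : cellL2In L ρ₀ h ≤ (Ck + CP) * 𝒟 := by
    by_cases hnil : vs' = []
    · have hhq : h = qt := by rw [hh, hnil]; rfl
      rw [hhq]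
      calc cellL2In L ρ₀ qt ≤ cellL2 L qt := cellL2In_le_cellL2 L ρ₀ hqt_s.continuousOn
        _ ≤ CP * cellL2 L (cylGrad q) := hCP q hq
        _ ≤ CP * 𝒟 := by
            refine mul_le_mul_of_nonneg_left ?_ hCP0
            have := Finset.sum_nonneg (s := Finset.range 3) fun m _ => Finset.sum_nonneg (s := Finset.univ)
              fun (w : Fin m → Fin (Module.finrank ℝ ℝ³)) _ =>
                cellL2_nonneg L (cylWord (jcWord (constWord fun j => b (w j))) (cylLap q))
            simp only [h𝒟]; linarith
        _ ≤ (Ck + CP) * 𝒟 := by nlinarith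
    · have hword : h = cylWord (jcWord (vs'.map some)) q := by rw [hh, cylWord_const_sub_const' _ hnil]
      rw [hword]
      have hlen : 1 ≤ vs'.length := by
        rw [Nat.one_le_iff_ne_zero]; exact fun h0 => hnil (List.eq_nil_of_length_eq_zero h0)
      calc _ ≤ Ck * 𝒟 := IH vs' hlen (by rw [hvs']; omega) hl'
        _ ≤ (Ck + CP) * 𝒟 := by nlinarith
  -- step 3b: the cross term
  have step3b : cellL2 L (fun x => (2 : ℝ) • ∑ i : Fin 3, cylDeriv (fun _ => cylBasis i) χ x • cylDeriv (fun _ => cylBasis i) h x) ≤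
      6 * A * Ck * 𝒟 := by
    rw [cellL2_const_smul, abs_of_pos (by norm_num : (0 : ℝ) < 2)]
    have hAi : ∀ (i : Fin 3), ∀ x ∈ 𝕂, |cylDeriv (fun _ => cylBasis i) χ x| ≤ A := fun i x hx => by
      have h := hA (fun _ => cylBasis i) x hx
      rwa [norm_cylBasis, mul_one] at h
    calc 2 * cellL2 L (fun x => ∑ i : Fin 3, cylDeriv (fun _ => cylBasis i) χ x • cylDeriv (fun _ => cylBasis i) h x)
        ≤ 2 * ∑ i : Fin 3, cellL2 L (fun x => cylDeriv (fun _ => cylBasis i) χ x • cylDeriv (fun _ => cylBasis i) h x) :=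
          mul_le_mul_of_nonneg_left (cellL2_sum_le L _ fun i _ => hT2i i) (by norm_num)
      _ ≤ 2 * ∑ i : Fin 3, A * (Ck * 𝒟) := by
          refine mul_le_mul_of_nonneg_left (Finset.sum_le_sum fun i _ => ?_) (by norm_num)
          exact (cellL2_smul_le_cellL2In L hA0 (hdχ0 i) (hAi i) (hdh i).continuousOn).trans
            (mul_le_mul_of_nonneg_left (hIHi i) hA0)
      _ = 6 * A * Ck * 𝒟 := by
          simp only [Finset.sum_const, Finset.card_univ, Fintype.card_fin, nsmul_eq_mul]; ring
  -- step 3c: the zeroth-order term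
  have step3c : cellL2 L (fun x => cylLap χ x • h x) ≤ B * ((Ck + CP) * 𝒟) :=
    (cellL2_smul_le_cellL2In L hB0 hLχ0 hB hh_s.continuousOn).trans (mul_le_mul_of_nonneg_left hIHh hB0)
  -- assemble
  have hM2 : 0 ≤ 9 * M ^ 2 := by positivity
  calc cellL2In L ρ₁ (cylWord (jcWord ((a :: a' :: vs').map some)) q)
      ≤ 9 * M ^ 2 * cellL2 L (cylLap v) := step1.trans step2
    _ ≤ 9 * M ^ 2 * ((Λ * M) ^ k * 𝒟 + 6 * A * Ck * 𝒟 + B * ((Ck + CP) * 𝒟)) :=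
        mul_le_mul_of_nonneg_left (step3.trans (add_le_add (add_le_add step3a step3b) step3c)) hM2
    _ = 9 * M ^ 2 * ((Λ * M) ^ k + 6 * A * Ck + B * (Ck + CP)) * 𝒟 := by ring

omit hL hM1 in
/-- Combining an induction hypothesis on `{r < ρ₀}` for lengths `≤ k + 1` with the step on `{r < ρ₁}`
for length `k + 2` gives the hypothesis on `{r < ρ₁}` for lengths `≤ k + 2`. [folklore] -/
theorem cellL2In_combine {ρ₁ ρ₀ : ℝ} (h10 : ρ₁ ≤ ρ₀) (k : ℕ) {Ck C : ℝ} (hCk : 0 ≤ Ck) (hC : 0 ≤ C)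
    {q : ℝ³ → ℝ} (hq : ContDiffOn ℝ ∞ q 𝕂) {D : ℝ} (hD : 0 ≤ D)
    (IH : ∀ vs : List ℝ³, 1 ≤ vs.length → vs.length ≤ k + 1 → (∀ v ∈ vs, ‖v‖ ≤ M) →
      cellL2In L ρ₀ (cylWord (jcWord (vs.map some)) q) ≤ Ck * D)
    (hstep : ∀ vs : List ℝ³, vs.length = k + 2 → (∀ v ∈ vs, ‖v‖ ≤ M) →
      cellL2In L ρ₁ (cylWord (jcWord (vs.map some)) q) ≤ C * D) :
    ∀ vs : List ℝ³, 1 ≤ vs.length → vs.length ≤ k + 2 → (∀ v ∈ vs, ‖v‖ ≤ M) →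
      cellL2In L ρ₁ (cylWord (jcWord (vs.map some)) q) ≤ (Ck + C) * D := by
  intro vs h1 h2 hl
  rcases Nat.lt_or_ge vs.length (k + 2) with hlt | hge
  · calc _ ≤ cellL2In L ρ₀ (cylWord (jcWord (vs.map some)) q) :=
          cellL2In_mono_radius L h10 (contDiffOn_cylWord_jcWord _ hq).continuousOn
      _ ≤ Ck * D := IH vs h1 (by omega) hl
      _ ≤ (Ck + C) * D := by nlinarith
  · calc _ ≤ C * D := hstep vs (by omega) hl
      _ ≤ (Ck + C) * D := by nlinarith

/-- **The interior estimate**: for `L > 0` and `M ≥ 1` there is `C` such that for every `q` smooth on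
the closed cylinder and `L`-periodic and every constant word of length `1 ≤ n ≤ 4` with letters of
norm `≤ M`,
`‖∂_{v₁}⋯∂_{v_n} q‖_{L²(cell ∩ {r < 1/2})} ≤ C (Σ_{m ≤ 2} Σ_w cellL2 (X_{e∘w} Δ_K q) + cellL2 (∇q))`.
Three applications of the step with the radii `7/8 > 3/4 > 5/8 > 1/2`. [folklore] -/
theorem exists_cellL2In_half_le :
    ∃ C : ℝ, 0 ≤ C ∧ ∀ (q : ℝ³ → ℝ), ContDiffOn ℝ ∞ q 𝕂 → IsAxiallyPeriodic L q →
      ∀ vs : List ℝ³, 1 ≤ vs.length → vs.length ≤ 4 → (∀ v ∈ vs, ‖v‖ ≤ M) →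
        cellL2In L (1 / 2) (cylWord (jcWord (vs.map some)) q) ≤
          C * (∑ m ∈ Finset.range 3, ∑ w : Fin m → Fin (Module.finrank ℝ ℝ³),
            cellL2 L (cylWord (jcWord (constWord fun j => Module.finBasis ℝ ℝ³ (w j))) (cylLap q)) + cellL2 L (cylGrad q)) := by
  have hM0 : 0 ≤ M := zero_le_one.trans hM1
  -- the three steps
  obtain ⟨C₁, hC₁0, hC₁⟩ := cellL2In_step hL hM1 (ρ₁ := 3 / 4) (ρ₀ := 7 / 8) (by norm_num) (by norm_num) (by norm_num)
    0 (by norm_num) hM0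
  obtain ⟨C₂, hC₂0, hC₂⟩ := cellL2In_step hL hM1 (ρ₁ := 5 / 8) (ρ₀ := 3 / 4) (by norm_num) (by norm_num) (by norm_num)
    1 (by norm_num) (add_nonneg hM0 hC₁0)
  obtain ⟨C₃, hC₃0, hC₃⟩ := cellL2In_step hL hM1 (ρ₁ := 1 / 2) (ρ₀ := 5 / 8) (by norm_num) (by norm_num) (by norm_num)
    2 (by norm_num) (add_nonneg (add_nonneg hM0 hC₁0) hC₂0)
  refine ⟨M + C₁ + C₂ + C₃, by positivity, fun q hq hqp => ?_⟩
  set D : ℝ := (∑ m ∈ Finset.range 3, ∑ w : Fin m → Fin (Module.finrank ℝ ℝ³),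
    cellL2 L (cylWord (jcWord (constWord fun j => Module.finBasis ℝ ℝ³ (w j))) (cylLap q)) + cellL2 L (cylGrad q)) with hD
  have hD0 : 0 ≤ D := add_nonneg (Finset.sum_nonneg fun m _ => Finset.sum_nonneg fun w _ => cellL2_nonneg L _)
    (cellL2_nonneg L _)
  -- level 0: words of length one on `{r < 7/8}`
  have I0 : ∀ vs : List ℝ³, 1 ≤ vs.length → vs.length ≤ 0 + 1 → (∀ v ∈ vs, ‖v‖ ≤ M) →
      cellL2In L (7 / 8) (cylWord (jcWord (vs.map some)) q) ≤ M * D := by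
    intro vs h1 h2 hl
    obtain ⟨v, vs', rfl⟩ := List.exists_of_length_succ vs (by omega : vs.length = 0 + 1)
    have hvs' : vs' = [] := List.eq_nil_of_length_eq_zero (by simpa using h2)
    subst hvs'
    refine (cellL2In_cylDeriv_le hM1 (7 / 8) hq (hl v (by simp))).trans ?_
    refine mul_le_mul_of_nonneg_left ?_ hM0
    have := Finset.sum_nonneg (s := Finset.range 3) fun m _ => Finset.sum_nonneg (s := Finset.univ)
      fun (w : Fin m → Fin (Module.finrank ℝ ℝ³)) _ =>
        cellL2_nonneg L (cylWord (jcWord (constWord fun j => Module.finBasis ℝ ℝ³ (w j))) (cylLap q))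
    simp only [hD]; linarith
  have I1 := cellL2In_combine (by norm_num : (3 : ℝ) / 4 ≤ 7 / 8) 0 hM0 hC₁0 hq hD0 I0 (hC₁ q hq hqp I0)
  have I2 := cellL2In_combine (by norm_num : (5 : ℝ) / 8 ≤ 3 / 4) 1 (add_nonneg hM0 hC₁0) hC₂0 hq hD0 I1
    (hC₂ q hq hqp I1)
  have I3 := cellL2In_combine (by norm_num : (1 : ℝ) / 2 ≤ 5 / 8) 2 (add_nonneg (add_nonneg hM0 hC₁0) hC₂0)
    hC₃0 hq hD0 I2 (hC₃ q hq hqp I2)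
  intro vs h1 h4 hl
  exact I3 vs h1 h4 hl

end Interior

end Literature.Analysis.FluidPDE
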